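import Summits.Parity.GeneralizedHardyLittlewood.Theorems.LeeYangFibresRelativeDimOneFloatingSecondMoment
import Summits.Parity.GeneralizedHardyLittlewood.Theorems.LeeYangFibresRelativeDimOneFloatingSiegelDefs
import Literature.NumberTheory.Sieve.MontgomeryVaughan1975Lemma43NonExceptional
import Literature.NumberTheory.LFunctions.SiegelZeroExceptionalPrimes
import Literature.Barriers.Parity.SiegelZeroDichotomy
import HarnessLib

/-!
# Route `LeeYangFibres`, crux `RelativeDimOne` (stmt-Parity-14113), line `floating-level-core` (lead seat c5):
# stub (S) `stub_siegelSecondMoment` — the class second moment to NON-EXCEPTIONAL moduli under a Siegel zero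

Registered stub of the checked skeleton `Cruxes/RelativeDimOne/Lines/floating_level_core.lean`:

  `stub_siegelSecondMoment : SiegelNonexcSecondMoment`

(vocabulary `Theorems/LeeYangFibresRelativeDimOneFloatingSiegelDefs.lean`): there is `c > 0` such that for every
`ε > 0` there are a level `0 < θ₁ ≤ 1/4` and `N₁` with: for every Siegel zero `(χ mod q, η)` (`IsSiegelZero`), every
`N ≥ N₁` with `q ≤ N^{θ₁}` inside the window `θ₁ log N ≤ c η log q`, and every modulus `1 ≤ d ≤ N^{θ₁}` with `q ∤ d`,
`Σ_{a mod d} ψ(N; d, a)² ≤ (1 + ε)(N²/φ(d) + N log N)`.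

## Proof

This is the landed stub (A) `stub_flatSecondMoment` (`…FloatingSecondMoment.lean`) with its analytic input
`linnikCharSum_of_noSiegelZeros` replaced by `linnikCharSum_of_siegelZero` below: the EXCEPTIONAL clause (second
conjunct) of the tree's UNCONDITIONAL DH-free Gallagher prime number theorem `gallagher_nonexceptional`
(Montgomery–Vaughan 1975 Lemma 4.3 = Gallagher 1970 Theorem 7, proved in the tree from the truncated explicit formulae
and Bombieri's log-free density theorem) for the datum `(r, χ̃, β̃) = (q, χ, 1 − 1/(η log q))`. Inside the window
`θ₁ log N ≤ c₁ η log q` this datum IS exceptional at level `P = N^{θ₁}` (`IsExceptionalZero c₁ P q χ β̃`: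
`log P = θ₁ log N`, so `1 − c₁/log P ≤ β̃`; `χ ≠ χ₀` as `χ` is primitive of modulus `q ≥ 2`). For a modulus `d ≤ P`
with `q ∤ d` no character mod `d` is induced by `χ` (its conductor would be `q ∣ d`), so the characters mod `d` embed
(`χ' ↦ (f_{χ'}, χ'⋆)`, `PrimesInAPGallagher.sum_conductor_primitiveCharacter_le_filter`) into the NON-exceptional
family of primitive characters of conductor `≤ P`, exactly as in the first case of
`PrimesInAPGallagher.sum_norm_gallagherTerm_le_nonexceptional`; unweighting `N + N/P ≤ 2N` gives
`Σ_{χ' mod d} ‖∑#_{p ≤ N} χ'⋆(p) log p‖ ≤ K e^{−c₁/θ₁} N`. The rest is VERBATIM the assembly of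
`stub_flatSecondMoment` at the modulus `d`: `‖ψ(N,χ')‖ ≤ ‖∑# χ'⋆‖ + log d + 2√N log N` for `χ' ≠ χ₀`
(`sum_norm_charPsi_le`), the level `θ₁(ε) ≤ min(θ₀, 1/4)` with `K e^{−c₁/θ₁} ≤ √ε/4` (`exists_level_exp_le`),
`φ(d) ≤ N^{1/4}`, Parseval on `(ℤ/dℤ)ˣ` (`totient_mul_sum_coprime_sq`, `sum_norm_sq_charPsi_le_sq_sum`), the prime
number theorem (`eventually_psi_le`) and the non-coprime classes (`sum_not_coprime_sq_le`).

References: Gallagher, Invent. Math. 11 (1970), Theorem 7 [Gallagher1970]; Montgomery–Vaughan, Acta Arith. 27 (1975)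
§4, Lemmas 4.1, 4.3 [MontgomeryVaughanActa1975]; Davenport, *Multiplicative Number Theory*, ch. 14, 20
[DavenportMNT1980]; Tao–Teräväinen, J. London Math. Soc. 106 (2022), Definition 1.4 [TaoTeravainen2021].
-/

noncomputable section

open scoped BigOperators Classical ArithmeticFunction.vonMangoldt
open Finset Filter Literature.NumberTheory.Sieve
open Literature.NumberTheory.Sieve.MontgomeryVaughan1975
open Summit.Parity.GeneralizedHardyLittlewood.Cruxes.RelativeDimOne.GallagherBackwards (classPsi charPsi)
open Summit.Parity.GeneralizedHardyLittlewood.Cruxes.RelativeDimOne.GallagherBackwardsSplit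
open Summit.Parity.GeneralizedHardyLittlewood.Cruxes.RelativeDimOne.TypeSplit
open Summit.Parity.GeneralizedHardyLittlewood.Cruxes.RelativeDimOne.TypeSplit.GRHCalibration

namespace Summit.Parity.GeneralizedHardyLittlewood.Cruxes.RelativeDimOne.FloatingLevelCore

/-! ### Gallagher's bound over the non-exceptional characters, per modulus `d` with `q ∤ d` -/

/-- **The Linnik-range character sum bound in the presence of a Siegel zero** (input of stub
`stub_siegelSecondMoment`): there are absolute `c, θ₀, K > 0` such that for every level exponent `0 < θ₁ ≤ θ₀` there
is `N₀` with: for every Siegel zero `(χ mod q, η)`, every `N ≥ N₀` with `q ≤ N^{θ₁}` in the window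
`θ₁ log N ≤ c η log q`, and every modulus `d ≤ N^{θ₁}` with `q ∤ d`,
`Σ_{χ' mod d} ‖Σ_{p ≤ N} χ'⋆(p) log p − [χ' = χ₀]·N‖ ≤ K e^{−c/θ₁} N`. The exceptional clause of the tree's
unconditional `gallagher_nonexceptional` at `x = h = N`, `P = N^{θ₁}`, for the datum `(q, χ, 1 − 1/(η log q))`, which
is exceptional at `(c, P)` inside the window; the characters mod `d` embed into the non-exceptional primitive
characters of conductor `≤ P` since none of them is induced by `χ` (`q ∤ d`). (Gallagher 1970, Theorem 7;
Montgomery–Vaughan 1975, Lemma 4.3.) -/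
theorem linnikCharSum_of_siegelZero :
    ∃ c : ℝ, 0 < c ∧ ∃ θ₀ : ℝ, 0 < θ₀ ∧ ∃ K : ℝ, 0 < K ∧ ∀ θ₁ : ℝ, 0 < θ₁ → θ₁ ≤ θ₀ → ∃ N₀ : ℕ,
      ∀ (q : ℕ) [NeZero q] (χ : DirichletCharacter ℂ q) (η : ℝ), Literature.Barriers.Parity.IsSiegelZero χ η →
        ∀ N : ℕ, N₀ ≤ N → (q : ℝ) ≤ (N : ℝ) ^ θ₁ → θ₁ * Real.log N ≤ c * η * Real.log q →
          ∀ (d : ℕ) [NeZero d], (d : ℝ) ≤ (N : ℝ) ^ θ₁ → ¬ q ∣ d →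
            ∑ χ' : DirichletCharacter ℂ d, ‖gallagherTerm χ'.primitiveCharacter N N‖ ≤
              K * Real.exp (-c / θ₁) * N := by
  classical
  obtain ⟨c₁, hc₁, c₄, hc₄, C, hG⟩ := gallagher_nonexceptional
  refine ⟨c₁, hc₁, c₄, hc₄, 2 * (max C 0 + 1), by positivity, fun θ₁ hθ₁ hθ₁c₄ => ?_⟩
  -- threshold: `N ≥ 2`, `log N ≥ 1/θ₁²` (so `exp √log N ≤ N^{θ₁}`), `N^{θ₁} ≥ 4`
  refine ⟨max 2 (max ⌈Real.exp (1 / θ₁ ^ 2)⌉₊ ⌈(4 : ℝ) ^ (1 / θ₁)⌉₊), ?_⟩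
  intro q _ χ η hZ N hN hqP hwin d _ hdP hqd
  obtain ⟨hprim, -, hη, hL⟩ := hZ
  have hN2 : 2 ≤ N := le_of_max_le_left hN
  have hNexp : ⌈Real.exp (1 / θ₁ ^ 2)⌉₊ ≤ N := le_of_max_le_left (le_of_max_le_right hN)
  have hN4 : ⌈(4 : ℝ) ^ (1 / θ₁)⌉₊ ≤ N := le_of_max_le_right (le_of_max_le_right hN)
  have hN1 : (1 : ℝ) ≤ N := by exact_mod_cast (show 1 ≤ N by omega)
  have hN0 : (0 : ℝ) < N := by linarith
  have hlogN0 : 0 < Real.log N := Real.log_pos (by exact_mod_cast (show 1 < N by omega))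
  set P : ℝ := (N : ℝ) ^ θ₁ with hPdef
  have hP0 : 0 < P := Real.rpow_pos_of_pos hN0 _
  have hlogN : 1 / θ₁ ^ 2 ≤ Real.log N := by
    have h1 : Real.exp (1 / θ₁ ^ 2) ≤ N := (Nat.le_ceil _).trans (by exact_mod_cast hNexp)
    have := Real.log_le_log (Real.exp_pos _) h1
    rwa [Real.log_exp] at this
  have hexp : Real.exp (Real.sqrt (Real.log N)) ≤ P := exp_sqrt_log_le_rpow hN1 hθ₁ hlogN
  have hPc₄ : P ≤ (N : ℝ) ^ c₄ := Real.rpow_le_rpow_of_exponent_le hN1 hθ₁c₄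
  have hP4 : 4 ≤ P := by
    have h1 : (4 : ℝ) ^ (1 / θ₁) ≤ N := (Nat.le_ceil _).trans (by exact_mod_cast hN4)
    have h2 : ((4 : ℝ) ^ (1 / θ₁)) ^ θ₁ ≤ P := Real.rpow_le_rpow (by positivity) h1 hθ₁.le
    rwa [← Real.rpow_mul (by norm_num), one_div_mul_cancel hθ₁.ne', Real.rpow_one] at h2
  have hlogP : Real.log P = θ₁ * Real.log N := by rw [hPdef, Real.log_rpow hN0]
  have hlogP0 : 0 < Real.log P := by rw [hlogP]; positivity
  -- the Siegel datum `(q, χ, 1 − 1/(η log q))` is exceptional at `(c₁, P)` inside the window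
  have hq2 : 2 ≤ q := Literature.NumberTheory.LFunctions.SiegelZero.two_le_of_LFunction_eq_zero hL
  have hχ1 : χ ≠ 1 := by
    intro h1
    rw [DirichletCharacter.isPrimitive_def, h1, DirichletCharacter.conductor_one] at hprim
    omega
  have hlogq : 0 < Real.log q := Real.log_pos (by exact_mod_cast (show 1 < q by omega))
  have hη0 : 0 < η := by linarith
  have hηlogq : 0 < η * Real.log q := mul_pos hη0 hlogq
  have hβ1 : 1 - 1 / (η * Real.log q) < 1 := by
    have : 0 < 1 / (η * Real.log q) := by positivity
    linarith
  have hβ : 1 - c₁ / Real.log P ≤ 1 - 1 / (η * Real.log q) := by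
    have h1 : 1 / (η * Real.log q) ≤ c₁ / Real.log P := by
      rw [div_le_div_iff₀ hηlogq hlogP0, one_mul, hlogP]
      linarith
    linarith
  have hExc : IsExceptionalZero c₁ P q χ (1 - 1 / (η * Real.log q)) := ⟨hprim, hχ1, hqP, hβ, hβ1, hL⟩
  -- Gallagher's exceptional clause at `x = h = N`
  have key := (hG N P hN2 hexp hPc₄ (fun _ _ => N) (fun _ _ => N) (fun _ _ => le_rfl)
    (fun _ _ => le_rfl)).2 q χ _ hExc
  have hlog : -c₁ * Real.log N / Real.log P = -c₁ / θ₁ := by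
    rw [hlogP]
    field_simp
  rw [hlog] at key
  -- embed the characters mod `d` into the non-exceptional primitive characters of conductor `≤ P`
  have hNP : 0 < (N : ℝ) + N / P := by positivity
  have hemb := PrimesInAPGallagher.sum_conductor_primitiveCharacter_le_filter hdP
    (fun q' ψ => ((N : ℝ) + N / P)⁻¹ * ‖gallagherTerm ψ N N‖) (fun q' ψ => by positivity)
    (fun q' ψ => ψ.IsPrimitive ∧ ¬ (q' = q ∧ ∀ n : ℕ, ψ (n : ZMod q') = χ (n : ZMod q)))
    (fun q' => inferInstance) (fun χ' => ⟨χ'.primitiveCharacter_isPrimitive, fun hh =>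
      hqd (hh.1 ▸ χ'.conductor_dvd_level)⟩)
  have hbound : ∑ χ' : DirichletCharacter ℂ d,
      ((N : ℝ) + N / P)⁻¹ * ‖gallagherTerm χ'.primitiveCharacter N N‖ ≤ C * Real.exp (-c₁ / θ₁) := by
    refine hemb.trans ?_
    convert key using 2
  have hsum : ∑ χ' : DirichletCharacter ℂ d, ‖gallagherTerm χ'.primitiveCharacter N N‖ =
      ((N : ℝ) + N / P) * ∑ χ' : DirichletCharacter ℂ d,
        ((N : ℝ) + N / P)⁻¹ * ‖gallagherTerm χ'.primitiveCharacter N N‖ := by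
    rw [Finset.mul_sum]
    refine Finset.sum_congr rfl fun χ' _ => ?_
    rw [← mul_assoc, mul_inv_cancel₀ hNP.ne', one_mul]
  -- unweight: `N + N/P ≤ 2N`
  have hP1 : 1 ≤ P := by linarith
  have hNP2 : (N : ℝ) + N / P ≤ 2 * N := by
    have : (N : ℝ) / P ≤ N := div_le_self hN0.le hP1
    linarith
  have hCK : C ≤ max C 0 + 1 := by have := le_max_left C 0; linarith
  rw [hsum]
  calc ((N : ℝ) + N / P) * ∑ χ' : DirichletCharacter ℂ d,
        ((N : ℝ) + N / P)⁻¹ * ‖gallagherTerm χ'.primitiveCharacter N N‖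
      ≤ (2 * N) * (C * Real.exp (-c₁ / θ₁)) :=
        mul_le_mul hNP2 hbound (Finset.sum_nonneg fun χ' _ => by positivity) (by positivity)
    _ ≤ (2 * N) * ((max C 0 + 1) * Real.exp (-c₁ / θ₁)) := by
        gcongr
    _ = 2 * (max C 0 + 1) * Real.exp (-c₁ / θ₁) * N := by ring

/-! ### The stub -/

/-- **`stub_siegelSecondMoment` (S)** (registered stub of the line `floating-level-core`, crux stmt-Parity-14113): in
the presence of a Siegel zero `(χ mod q, η)`, for `N` in the window `q ≤ N^{θ₁}`, `θ₁ log N ≤ c η log q` and every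
modulus `1 ≤ d ≤ N^{θ₁}` with `q ∤ d`, `Σ_{a mod d} ψ(N; d, a)² ≤ (1 + ε)(N²/φ(d) + N log N)` — the level
`θ₁ = θ₁(ε) ≤ 1/4` floating with the accuracy. The landed `stub_flatSecondMoment` with its input replaced by
`linnikCharSum_of_siegelZero` (exceptional clause of the unconditional `gallagher_nonexceptional`) + Parseval on
`(ℤ/dℤ)ˣ`. (Gallagher 1970, Theorem 7.) -/
theorem stub_siegelSecondMoment : SiegelNonexcSecondMoment := by
  obtain ⟨c, hc, θ₀, hθ₀, K, hK, hLin⟩ := linnikCharSum_of_siegelZero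
  refine ⟨c, hc, fun ε hε => ?_⟩
  -- accuracy `ε' = min ε 1`
  set ε' := min ε 1 with hε'
  have hε'0 : 0 < ε' := lt_min hε one_pos
  have hε'1 : ε' ≤ 1 := min_le_right _ _
  have hε'ε : ε' ≤ ε := min_le_left _ _
  have hsq : 0 < Real.sqrt ε' := Real.sqrt_pos.2 hε'0
  have hsq2 : Real.sqrt ε' ^ 2 = ε' := Real.sq_sqrt hε'0.le
  -- the level: `θ₁ ≤ min θ₀ (1/4)` with `K e^{−c/θ₁} ≤ √ε'/4`
  obtain ⟨θ₁, hθ₁, hθ₁le, hexp⟩ := exists_level_exp_le hc (lt_min hθ₀ (by norm_num : (0 : ℝ) < 1 / 4))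
    (show 0 < Real.sqrt ε' / (4 * K) by positivity)
  have hθ₁θ₀ : θ₁ ≤ θ₀ := hθ₁le.trans (min_le_left _ _)
  have hθ₁4 : θ₁ ≤ 1 / 4 := hθ₁le.trans (min_le_right _ _)
  have hKexp : K * Real.exp (-c / θ₁) ≤ Real.sqrt ε' / 4 := by
    calc K * Real.exp (-c / θ₁) ≤ K * (Real.sqrt ε' / (4 * K)) := mul_le_mul_of_nonneg_left hexp hK.le
      _ = Real.sqrt ε' / 4 := by field_simp
  obtain ⟨N₁, hN₁⟩ := hLin θ₁ hθ₁ hθ₁θ₀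
  -- thresholds (all at the FIXED exponents `3/4`, `1/4`; chosen after `θ₁`, i.e. after `ε`)
  have hδ : (0 : ℝ) < ε' / 5 := by positivity
  obtain ⟨N₀, hN₀⟩ := Filter.eventually_atTop.1 ((eventually_psi_le hδ).and
    (((eventually_rpow_mul_log_pow_le (show (3 / 4 : ℝ) < 1 by norm_num) 1 (show (0 : ℝ) ≤ 3 by norm_num)
        (show 0 < Real.sqrt ε' / 4 by positivity)).and
      (eventually_rpow_mul_log_pow_le (show (1 / 4 : ℝ) < 1 by norm_num) 2 (show (0 : ℝ) ≤ 9 by norm_num)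
        (show 0 < ε' / 4 by positivity))).and
        (eventually_ge_atTop (max N₁ 2))))
  refine ⟨θ₁, hθ₁, hθ₁4, N₀, ?_⟩
  intro q _ χ η hZ N hN hqθ hwin d hd hdθ hqd
  obtain ⟨hpsi, ⟨hE2, hE3⟩, hNmax⟩ := hN₀ N hN
  have hNN₁ : N₁ ≤ N := le_of_max_le_left hNmax
  have hN2 : 2 ≤ N := le_of_max_le_right hNmax
  haveI : NeZero d := ⟨by omega⟩
  have hN1 : 1 ≤ N := by omega
  have hNr : (1 : ℝ) ≤ N := by exact_mod_cast hN1
  have hNpos : (0 : ℝ) < N := by positivity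
  -- `d ≤ N^{θ₁} ≤ N^{1/4} ≤ N`
  have hθ14 : (N : ℝ) ^ θ₁ ≤ (N : ℝ) ^ (1 / 4 : ℝ) := Real.rpow_le_rpow_of_exponent_le hNr hθ₁4
  have hdN : d ≤ N := by
    have : (d : ℝ) ≤ N := hdθ.trans (by
      calc (N : ℝ) ^ θ₁ ≤ (N : ℝ) ^ (1 : ℝ) := Real.rpow_le_rpow_of_exponent_le hNr (by linarith)
        _ = N := Real.rpow_one _)
    exact_mod_cast this
  have hφpos : (0 : ℝ) < d.totient := by exact_mod_cast Nat.totient_pos.2 (by omega)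
  have hφd : (d.totient : ℝ) ≤ d := by exact_mod_cast Nat.totient_le d
  have hφ4 : (d.totient : ℝ) ≤ (N : ℝ) ^ (1 / 4 : ℝ) := hφd.trans (hdθ.trans hθ14)
  have h40 : 0 ≤ (N : ℝ) ^ (1 / 4 : ℝ) := Real.rpow_nonneg hNpos.le _
  -- the ℓ¹ bound on the non-principal characters mod `d`: `T ≤ (√ε'/2) N`
  set T := ∑ χ' ∈ (univ : Finset (DirichletCharacter ℂ d)).erase 1, ‖charPsi χ' N‖ with hTdef
  have hT0 : 0 ≤ T := sum_nonneg fun _ _ => norm_nonneg _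
  have hlogN : 0 ≤ Real.log N := Real.log_nonneg hNr
  have hsqN : 1 ≤ Real.sqrt N := by
    rw [show (1 : ℝ) = Real.sqrt 1 from Real.sqrt_one.symm]
    exact Real.sqrt_le_sqrt hNr
  have hjunk : Real.log d + 2 * Real.sqrt N * Real.log N ≤ 3 * Real.sqrt N * Real.log N := by
    have hd0 : (0 : ℝ) < d := by exact_mod_cast (show 0 < d by omega)
    have h1 : Real.log d ≤ Real.log N := Real.log_le_log hd0 (by exact_mod_cast hdN)
    have h2 : Real.log N ≤ Real.sqrt N * Real.log N := le_mul_of_one_le_left hlogN hsqN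
    linarith
  have h34 : (N : ℝ) ^ (1 / 4 : ℝ) * Real.sqrt N = (N : ℝ) ^ (3 / 4 : ℝ) := by
    rw [Real.sqrt_eq_rpow, ← Real.rpow_add hNpos]
    norm_num
  have hT : T ≤ Real.sqrt ε' / 2 * N := by
    have h1 : T ≤ K * Real.exp (-c / θ₁) * N +
        (d.totient : ℝ) * (Real.log d + 2 * Real.sqrt N * Real.log N) := by
      have ha := sum_norm_charPsi_le (q := d) hN1
      have hb := hN₁ q χ η hZ N hNN₁ hqθ hwin d hdθ hqd
      linarith
    have h2 : K * Real.exp (-c / θ₁) * N ≤ Real.sqrt ε' / 4 * N := mul_le_mul_of_nonneg_right hKexp hNpos.le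
    have h3 : (d.totient : ℝ) * (Real.log d + 2 * Real.sqrt N * Real.log N) ≤ Real.sqrt ε' / 4 * N := by
      calc (d.totient : ℝ) * (Real.log d + 2 * Real.sqrt N * Real.log N)
          ≤ (N : ℝ) ^ (1 / 4 : ℝ) * (3 * Real.sqrt N * Real.log N) :=
            mul_le_mul hφ4 hjunk (by positivity) h40
        _ = 3 * (N : ℝ) ^ (3 / 4 : ℝ) * Real.log N ^ 1 := by rw [← h34]; ring
        _ ≤ Real.sqrt ε' / 4 * N := hE2
    linarith
  have hT2 : T ^ 2 ≤ ε' / 4 * (N : ℝ) ^ 2 := by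
    calc T ^ 2 ≤ (Real.sqrt ε' / 2 * N) ^ 2 := pow_le_pow_left₀ hT0 hT 2
      _ = Real.sqrt ε' ^ 2 / 4 * (N : ℝ) ^ 2 := by ring
      _ = ε' / 4 * (N : ℝ) ^ 2 := by rw [hsq2]
  -- coprime classes (Parseval)
  have hcop : (d.totient : ℝ) * ∑ a ∈ (range d).filter (fun a => a.Coprime d), classPsi N d a ^ 2 ≤
      Chebyshev.psi N ^ 2 + T ^ 2 := by
    rw [totient_mul_sum_coprime_sq]
    exact sum_norm_sq_charPsi_le_sq_sum N
  -- non-coprime classes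
  have hnc : ∑ a ∈ (range d).filter (fun a => ¬ a.Coprime d), classPsi N d a ^ 2 ≤ 9 * N * Real.log N ^ 2 :=
    sum_not_coprime_sq_le hN1 hdN
  -- assemble `φ(d) · Σ_a ψ(N;d,a)² ≤ (1 + ε') N²`
  have hsplit := sum_filter_add_sum_filter_not (range d) (fun a => a.Coprime d) (fun a => classPsi N d a ^ 2)
  have hψ0 : 0 ≤ Chebyshev.psi N := Chebyshev.psi_nonneg _
  have hψ2 : Chebyshev.psi N ^ 2 ≤ (1 + ε' / 2) * (N : ℝ) ^ 2 := by
    have h1 : Chebyshev.psi N ^ 2 ≤ ((1 + ε' / 5) * N) ^ 2 := pow_le_pow_left₀ hψ0 hpsi 2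
    have h2 : (1 + ε' / 5) ^ 2 ≤ 1 + ε' / 2 := by nlinarith
    calc Chebyshev.psi N ^ 2 ≤ ((1 + ε' / 5) * N) ^ 2 := h1
      _ = (1 + ε' / 5) ^ 2 * (N : ℝ) ^ 2 := by ring
      _ ≤ (1 + ε' / 2) * (N : ℝ) ^ 2 := mul_le_mul_of_nonneg_right h2 (sq_nonneg _)
  have hnc2 : (d.totient : ℝ) * (9 * N * Real.log N ^ 2) ≤ ε' / 4 * (N : ℝ) ^ 2 := by
    calc (d.totient : ℝ) * (9 * N * Real.log N ^ 2) ≤ (N : ℝ) ^ (1 / 4 : ℝ) * (9 * N * Real.log N ^ 2) := by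
          gcongr
      _ = (9 * (N : ℝ) ^ (1 / 4 : ℝ) * Real.log N ^ 2) * N := by ring
      _ ≤ (ε' / 4 * N) * N := mul_le_mul_of_nonneg_right hE3 hNpos.le
      _ = ε' / 4 * (N : ℝ) ^ 2 := by ring
  have htot : (d.totient : ℝ) * ∑ a ∈ range d, classPsi N d a ^ 2 ≤ (1 + ε') * (N : ℝ) ^ 2 := by
    rw [← hsplit, mul_add]
    have hnc' : (d.totient : ℝ) * ∑ a ∈ (range d).filter (fun a => ¬ a.Coprime d), classPsi N d a ^ 2 ≤
        ε' / 4 * (N : ℝ) ^ 2 := (mul_le_mul_of_nonneg_left hnc hφpos.le).trans hnc2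
    linarith
  -- divide by `φ(d)` and add the (unused) `N log N` slack
  have hNlog : 0 ≤ (N : ℝ) * Real.log N := mul_nonneg hNpos.le hlogN
  have hdiv : ∑ a ∈ range d, classPsi N d a ^ 2 ≤ (1 + ε') * ((N : ℝ) ^ 2 / d.totient) := by
    rw [mul_div_assoc', le_div_iff₀ hφpos, mul_comm]
    exact htot
  calc ∑ a ∈ range d, classPsi N d a ^ 2 ≤ (1 + ε') * ((N : ℝ) ^ 2 / d.totient) := hdiv
    _ ≤ (1 + ε) * ((N : ℝ) ^ 2 / d.totient) := by
        gcongr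
    _ ≤ (1 + ε) * ((N : ℝ) ^ 2 / d.totient + N * Real.log N) := by
        have : 0 ≤ 1 + ε := by linarith
        gcongr
        linarith

end Summit.Parity.GeneralizedHardyLittlewood.Cruxes.RelativeDimOne.FloatingLevelCore

end
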